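import Literature.Barriers.Parity.EquidistributionLimitsProofs
import HarnessLib

/-!
# The two-moduli form of the barrier `EquidistributionLimitBarrier`
# (Granville–Soundararajan 2007, proof of Theorem 2.4: `Δ_q + Δ_ℓ ≫ 1`)

Audit companion (D-0021 barrier audit) of `Literature/Barriers/Parity/EquidistributionLimits.lean`,
sibling of `EquidistributionLimitsScope.lean` (the void regimes). Everything here is PROVED, by
re-running the final assembly of the tree's proof `EquidistributionLimitBarrier_holds`
(`EquidistributionLimitsProofs.lean`) with a stronger conclusion that the proof visibly supports.

`equidistributionLimit_twoModuli`: for `u ≥ 1` there are `c(u) > 0` and `x₀(u)` such that for every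
`x ≥ x₀` there are TWO moduli fixed in advance of the set — a `(log x)`-smooth
`q = q(x) ≤ min(x^{log 2}, x/(log x)^u)` (the product of the primes in the window
`(t^{4N+3}, t^{4N+4}]`, `t^{4N+4} ≤ (log x)/2`, `N = ⌊u⌋ + 1`) and a PRIME `ℓ = ℓ(x)` with
`x/(8(log x)^{N+1}) < ℓ ≤ x/(log x)^u` — such that EVERY subset of the primes is `c`-irregular at
scale `x` to `q` or to `ℓ`. This is the inequality `Δ_q + Δ_ℓ ≫ exp(-u(1+25η)log(2u/η²))` of the
source's proof of Theorem 2.4 (its Proposition 2.2 applied to `q = ∏_{z^{1-η} < p < z} p ≤ x^{1/3+o(1)}`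
and a rough `ℓ ∈ (x/(2(z^λ+1)), x/(2z^λ))`, `λ ∈ [u, u(1+22η)]`)
[cite: GranvilleSoundararajan2007Uncertainty, §4 (proof of Theorem 2.4) and §2 Proposition 2.2]; the
statement of Theorem 2.4 / Corollary 1.3 / Example 4 only keeps "`max_{ℓ ≤ x/z^u} Δ_ℓ ≫ …`".
Corollary: `equidistributionLimit_uniform` (the barrier with `x₀ = x₀(u)` independent of `𝒜`,
the order of quantifiers of the source's Corollary 1.3: "Let `x` be sufficiently large … Then …")
which implies the catalogued statement verbatim.

What this says for route design (recorded in the barrier's scope caveats): the obstruction names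
ONE smooth modulus `q(x) ≤ x^{0.7}` and ONE prime modulus `ℓ(x)` of size `x/(log x)^{O_u(1)}` per
scale; a subset of the primes may consistently be regular to every modulus outside such pairs, and
regular to one member of each pair. For the primes themselves the source removes the dichotomy
(Theorems 5.1/5.2: every, resp. almost every, large modulus is bad at some nearby scale), which is
NOT transcribed in the tree [cite: GranvilleSoundararajan2007Uncertainty, Theorems 5.1, 5.2].
-/

noncomputable section

open Filter Finset

namespace Literature.Barriers.Parity

/-- The conclusion of `EquidistributionLimitBarrier` at one scale `x` for the set `𝒜`, exponent `u`
and constant `c` (local notation, literally the body of the barrier; as in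
`EquidistributionLimitsScope.lean`). -/
local notation3 "IrregularAt[" 𝒜 ", " u ", " c ", " x "]" =>
  ∃ ℓ : ℕ, 1 ≤ ℓ ∧ (ℓ : ℝ) ≤ x / Real.log x ^ (u : ℝ) ∧
    ∃ y : ℝ, x / 4 < y ∧ y < x ∧ ∃ a : ℕ, Nat.Coprime a ℓ ∧
      (c : ℝ) * ((subsetCount 𝒜 x : ℝ) / (Nat.totient ℓ : ℝ)) ≤
        |(subsetCountMod 𝒜 ℓ a y : ℝ) - 1 / (Nat.totient ℓ : ℝ) * (y * (subsetCount 𝒜 x : ℝ) / x)|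

/-- The sieving primes of `EquidistributionLimitsProofs.lean`: `{p prime : t^{4N+3} < p ≤ t^{4N+4}}`. -/
local notation3 "Pr(" t ", " N ")" =>
  Nat.primesLE (t ^ (4 * N + 4)) \ Nat.primesLE (t ^ (4 * N + 3))

/-- **The two-moduli form (uncertainty principle for subsets of the primes).** For every `u ≥ 1`
there are `c > 0` and `x₀`, depending on `u` ONLY, such that for every `x ≥ x₀` there exist a
`(log x)`-smooth modulus `q ≤ min(x^{log 2}, x/(log x)^u)` (every prime factor of `q` is `≤ log x`)
and a PRIME modulus `ℓ` with `x/(8 (log x)^{⌊u⌋+2}) < ℓ ≤ x/(log x)^u`, both chosen before `𝒜`,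
such that EVERY subset `𝒜` of the primes is `c`-irregular at scale `x` to `q` or to `ℓ`:
for `m = q` or `m = ℓ` there are `y ∈ (x/4, x)` and `(a, m) = 1` with
`|𝒜(y; m, a) - y𝒜(x)/(xφ(m))| ≥ c 𝒜(x)/φ(m)`. This is the inequality `Δ_q + Δ_ℓ ≫ 1` of the
source's proof of Theorem 2.4 (Proposition 2.2 for the pair `q`, `ℓ`), here with the parameters of
the tree's proof `EquidistributionLimitBarrier_holds` (`q = ∏_{t^{4N+3} < p ≤ t^{4N+4}} p`,
`t = ⌊(log x/2)^{1/(4N+4)}⌋`, `N = ⌊u⌋ + 1`, `ℓ` a Bertrand prime in `(x/(8t^E), x/(4t^E)]`,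
`E = (4N+4)N+N+1`). Nothing is asserted about any other modulus.
[cite: GranvilleSoundararajan2007Uncertainty, §4 (proof of Theorem 2.4: "Δ_q + Δ_ℓ ≫ exp(−u(1+25η) log(2u/η²))") and §2 Proposition 2.2] -/
theorem equidistributionLimit_twoModuli (u : ℝ) (hu : 1 ≤ u) :
    ∃ c : ℝ, 0 < c ∧ ∃ x₀ : ℝ, ∀ x : ℝ, x₀ ≤ x →
      ∃ q ℓ : ℕ,
        (1 ≤ q ∧ (q : ℝ) ≤ x / Real.log x ^ u ∧ (q : ℝ) ≤ x ^ Real.log 2 ∧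
          ∀ p : ℕ, p.Prime → p ∣ q → (p : ℝ) ≤ Real.log x) ∧
        (ℓ.Prime ∧ (ℓ : ℝ) ≤ x / Real.log x ^ u ∧
          x / (8 * Real.log x ^ (⌊u⌋₊ + 2)) < ℓ) ∧
        ∀ 𝒜 : Set ℕ, (∀ n ∈ 𝒜, n.Prime) →
          ∃ m : ℕ, (m = q ∨ m = ℓ) ∧ ∃ y : ℝ, x / 4 < y ∧ y < x ∧ ∃ a : ℕ, a.Coprime m ∧
            c * ((subsetCount 𝒜 x : ℝ) / (Nat.totient m : ℝ)) ≤
              |(subsetCountMod 𝒜 m a y : ℝ) -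
                1 / (Nat.totient m : ℝ) * (y * (subsetCount 𝒜 x : ℝ) / x)| := by
  /- parameters depending on `u` (verbatim from `EquidistributionLimitBarrier_holds`) -/
  obtain ⟨N, hN, hN1, huN⟩ : ∃ N : ℕ, N = ⌊u⌋₊ + 1 ∧ 1 ≤ N ∧ u < N :=
    ⟨⌊u⌋₊ + 1, rfl, by omega, by push_cast; exact Nat.lt_floor_add_one u⟩
  have hNR : (1 : ℝ) ≤ N := by exact_mod_cast hN1
  obtain ⟨κ, hκ⟩ : ∃ κ : ℝ, κ = Real.log (((4 * N + 4 : ℕ) : ℝ) / ((4 * N + 3 : ℕ) : ℝ)) := ⟨_, rfl⟩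
  have ha0 : (0 : ℝ) < ((4 * N + 3 : ℕ) : ℝ) := by positivity
  have hb0 : (0 : ℝ) < ((4 * N + 4 : ℕ) : ℝ) := by positivity
  have hκ0 : 0 < κ := by
    rw [hκ]
    refine Real.log_pos ?_
    rw [one_lt_div ha0]
    push_cast
    linarith
  have hκ1 : κ ≤ 4 / 5 := by
    rw [hκ]
    have h := Real.log_le_sub_one_of_pos (div_pos hb0 ha0)
    have h7 : (7 : ℝ) ≤ ((4 * N + 3 : ℕ) : ℝ) := by push_cast; linarith
    have hid : ((4 * N + 4 : ℕ) : ℝ) / ((4 * N + 3 : ℕ) : ℝ) - 1 = 1 / ((4 * N + 3 : ℕ) : ℝ) := by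
      rw [div_sub_one ha0.ne']
      push_cast
      ring
    rw [hid] at h
    have : 1 / ((4 * N + 3 : ℕ) : ℝ) ≤ 1 / 7 := one_div_le_one_div_of_le (by norm_num) h7
    linarith
  obtain ⟨δ₁, hδ₁⟩ : ∃ δ₁ : ℝ, δ₁ = (κ / 2) ^ (N + 1) / (2 * ((N + 1).factorial : ℝ)) := ⟨_, rfl⟩
  have hδ₁0 : 0 < δ₁ := by rw [hδ₁]; positivity
  have hδ₁1 : δ₁ ≤ 1 := by
    rw [hδ₁, div_le_one (by positivity)]
    have h1 : (κ / 2) ^ (N + 1) ≤ 1 := pow_le_one₀ (by positivity) (by linarith)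
    have h2 : (1 : ℝ) ≤ ((N + 1).factorial : ℝ) := by exact_mod_cast (N + 1).factorial_pos
    linarith
  obtain ⟨c, hc⟩ : ∃ c : ℝ, c = δ₁ / 100 := ⟨_, rfl⟩
  have hc0 : 0 < c := by rw [hc]; positivity
  have hc1 : c ≤ 1 / 100 := by rw [hc]; linarith
  /- the threshold in `t` -/
  obtain ⟨t₁, ht₁⟩ := sum_inv_primes_window (a := 4 * N + 3) (b := 4 * N + 4) (by omega) (by omega)
    (ε := κ / 4) (by positivity)
  obtain ⟨t₀, ht₀⟩ := eventually_atTop.mp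
    (eventually_large_t t₁ (4 * ((N : ℝ) + 1) / κ) (1 / c) ((2 : ℝ) ^ N / (7 / 10 * δ₁)))
  /- the threshold in `x` -/
  have hγ : 0 < (N : ℝ) + 1 / 4 - u := by linarith
  obtain ⟨x₁, hx₁⟩ := eventually_atTop.mp
    (eventually_large_x N (u := u) (γ := (N : ℝ) + 1 / 4 - u) hγ (by ring)
      (2 * ((t₀ : ℝ) + 1) ^ (4 * N + 4))
      (((2 : ℝ) ^ (4 * N + 5)) ^ ((N : ℝ) + 1 / 4)) (C₇ := 8 * (1 / c + 1)) (by positivity) c)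
  refine ⟨c, hc0, max x₁ (Real.exp 2), fun x hx => ?_⟩
  obtain ⟨hX2, hX3, hX4, hX6, hX7⟩ := hx₁ x (le_of_max_le_left hx)
  have hxe : Real.exp 2 ≤ x := le_of_max_le_right hx
  have hx0 : 0 < x := (Real.exp_pos 2).trans_le hxe
  have hlogx : 2 ≤ Real.log x := by rw [Real.le_log_iff_exp_le hx0]; exact hxe
  have hlog0 : 0 < Real.log x := by linarith
  have hlog1 : 1 ≤ Real.log x := by linarith
  /- `t` -/
  obtain ⟨t, ht⟩ : ∃ t : ℕ, t = ⌊(Real.log x / 2) ^ (((4 * N + 4 : ℕ) : ℝ)⁻¹)⌋₊ := ⟨_, rfl⟩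
  obtain ⟨ht1, htb_le, htb_gt, htE_le, hlogE⟩ := t_pow_facts N hlogx ht
  have ht₀t : t₀ ≤ t := by
    have h1 : ((t₀ : ℝ) + 1) ^ (4 * N + 4) ≤ Real.log x / 2 := by linarith only [hX2]
    have h2 : ((t₀ : ℝ) + 1) ^ (4 * N + 4) < ((t : ℝ) + 1) ^ (4 * N + 4) := h1.trans_lt htb_gt
    have h3 : (t₀ : ℝ) + 1 < (t : ℝ) + 1 := lt_of_pow_lt_pow_left₀ _ (by positivity) h2
    have h5 : t₀ < t + 1 := by exact_mod_cast (by linarith only [h3] : (t₀ : ℝ) < (t : ℝ) + 1)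
    omega
  obtain ⟨ht1', ht2', ht3', ht4', ht5'⟩ := ht₀ t ht₀t
  obtain ⟨hs1, hs2, hta, htbig⟩ :=
    t_threshold_facts (N := N) hκ0 hδ₁0 ht2' (by have h := ht₁ t ht1'; rwa [← hκ] at h) ht3' ht5'
  -- `(log x)^u ≤ 4 t^E`
  have hlogu : Real.log x ^ u ≤ 4 * (t : ℝ) ^ ((4 * N + 4) * N + N + 1) := by
    have hC₆ : (0 : ℝ) < ((2 : ℝ) ^ (4 * N + 5)) ^ ((N : ℝ) + 1 / 4) := by positivity
    refine le_of_mul_le_mul_right ?_ hC₆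
    calc Real.log x ^ u * ((2 : ℝ) ^ (4 * N + 5)) ^ ((N : ℝ) + 1 / 4)
        ≤ 4 * Real.log x ^ ((N : ℝ) + 1 / 4) := hX6
      _ ≤ 4 * (((2 : ℝ) ^ (4 * N + 5)) ^ ((N : ℝ) + 1 / 4) * (t : ℝ) ^ ((4 * N + 4) * N + N + 1)) :=
          by linarith only [hlogE]
      _ = 4 * (t : ℝ) ^ ((4 * N + 4) * N + N + 1) * ((2 : ℝ) ^ (4 * N + 5)) ^ ((N : ℝ) + 1 / 4) :=
          by ring
  /- the sieving modulus `q` -/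
  obtain ⟨hq1, hqL, hqcx⟩ := q_facts N t hx0 hlog0 htb_le hX3 hX4 hc0 (u := u)
  have hPprime : ∀ p ∈ Pr(t, N), p.Prime := fun p hp => (mem_primes_window hp).1
  have hqsmooth : ∀ p : ℕ, p.Prime → p ∣ ∏ p ∈ Pr(t, N), p → (p : ℝ) ≤ Real.log x := by
    intro p hp hdvd
    obtain ⟨p', hp', hpp'⟩ := (Prime.dvd_finsetProd_iff hp.prime _).mp hdvd
    obtain ⟨hp'p, -, hp'le⟩ := mem_primes_window hp'
    have heq : p = p' := (Nat.prime_dvd_prime_iff_eq hp hp'p).mp hpp'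
    have h1 : (p : ℝ) ≤ (t : ℝ) ^ (4 * N + 4) := by rw [heq]; exact_mod_cast hp'le
    linarith
  have hqx2 : ((∏ p ∈ Pr(t, N), p : ℕ) : ℝ) ≤ x ^ Real.log 2 := by
    have h1 : ((∏ p ∈ Pr(t, N), p : ℕ) : ℝ) ≤ ((4 ^ (t ^ (4 * N + 4)) : ℕ) : ℝ) := by
      exact_mod_cast prod_primes_window_le_four_pow t N
    have h2 : ((4 ^ (t ^ (4 * N + 4)) : ℕ) : ℝ) = (4 : ℝ) ^ (((t ^ (4 * N + 4) : ℕ) : ℝ)) := by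
      rw [Real.rpow_natCast]; push_cast; ring
    have h3 : (4 : ℝ) ^ (((t ^ (4 * N + 4) : ℕ) : ℝ)) ≤ (4 : ℝ) ^ (Real.log x / 2) := by
      apply Real.rpow_le_rpow_of_exponent_le (by norm_num)
      push_cast; exact htb_le
    have h4 : (4 : ℝ) ^ (Real.log x / 2) = x ^ Real.log 2 := by
      rw [show (4 : ℝ) = 2 ^ (2 : ℝ) by norm_num, ← Real.rpow_mul (by norm_num),
        show (2 : ℝ) * (Real.log x / 2) = Real.log x by ring,
        Real.rpow_def_of_pos (by norm_num : (0 : ℝ) < 2), Real.rpow_def_of_pos hx0, mul_comm]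
    calc ((∏ p ∈ Pr(t, N), p : ℕ) : ℝ) ≤ ((4 ^ (t ^ (4 * N + 4)) : ℕ) : ℝ) := h1
      _ = (4 : ℝ) ^ (((t ^ (4 * N + 4) : ℕ) : ℝ)) := h2
      _ ≤ (4 : ℝ) ^ (Real.log x / 2) := h3
      _ = x ^ Real.log 2 := h4
  /- the row modulus `ℓ` (Bertrand) -/
  have htE_le' : (t : ℝ) ^ ((4 * N + 4) * N + N + 1) ≤ Real.log x ^ (N + 2) :=
    htE_le.trans (pow_le_pow_right₀ hlog1 (by omega))
  have htb_le' : (t : ℝ) ^ (4 * N + 4) ≤ Real.log x := by linarith only [htb_le, hlog0]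
  obtain ⟨ℓ, hℓp, hℓB, hℓlo, hℓhi, hJ1, hJ2⟩ :=
    exists_bertrand_prime (pow_pos (by omega) _) (Nat.one_le_pow _ _ (by omega))
      (bertrand_input hc0 hlog0 ht1 htE_le htb_le' hX7)
  push_cast at hℓlo hℓhi
  obtain ⟨hℓL, hℓc, hℓx⟩ := ell_facts hx0 hlog0 hc0 ht1 ht4' htE_le' hX7 hlogu hℓlo hℓhi
  have hcop := coprime_prod_primes_window hℓp hℓB (N := N)
  -- the lower bound `x/(8 (log x)^{N+1}) < ℓ`
  have hℓlow : x / (8 * Real.log x ^ (⌊u⌋₊ + 2)) < ℓ := by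
    have htEpos : (0 : ℝ) < (t : ℝ) ^ ((4 * N + 4) * N + N + 1) := by
      have : (0 : ℝ) < t := by exact_mod_cast ht1
      positivity
    have h1 : x / (8 * Real.log x ^ (N + 1)) ≤ x / (8 * (t : ℝ) ^ ((4 * N + 4) * N + N + 1)) :=
      div_le_div_of_nonneg_left hx0.le (by positivity) (by linarith only [htE_le])
    rw [show ⌊u⌋₊ + 2 = N + 1 by omega]
    exact h1.trans_lt hℓlo
  refine ⟨∏ p ∈ Pr(t, N), p, ℓ, ⟨hq1, hqL, hqx2, hqsmooth⟩, ⟨hℓp, hℓL, hℓlow⟩, fun 𝒜 h𝒜 => ?_⟩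
  /- negate the dichotomy at `x` and conclude as in `EquidistributionLimitBarrier_holds` -/
  by_contra hcon
  simp only [not_exists, not_and, not_le] at hcon
  have hregℓ := hcon ℓ (Or.inr rfl)
  have hregq := hcon (∏ p ∈ Pr(t, N), p) (Or.inl rfl)
  have hmat := maierMatrix_bounds h𝒜 hℓp hq1 hcop hc0 hc1 hℓc hℓx hqcx hregℓ hregq
  exact sieve_side_contradiction ht2' hκ0 hκ1 hδ₁ hc hs1 hs2 hta hJ1 hJ2 htbig hmat

/-- **Uniformity in the set.** The barrier with the threshold `x₀ = x₀(u)` chosen BEFORE the subset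
`𝒜` (the source's "Let x be sufficiently large" precedes the choice of the sequence; the tree's
statement `EquidistributionLimitBarrier` has the weaker order `∀ 𝒜, ∃ x₀`).
[cite: GranvilleSoundararajan2007Uncertainty, Corollary 1.3 and Example 4] -/
theorem equidistributionLimit_uniform (u : ℝ) (hu : 1 ≤ u) :
    ∃ c : ℝ, 0 < c ∧ ∃ x₀ : ℝ, ∀ 𝒜 : Set ℕ, (∀ n ∈ 𝒜, n.Prime) →
      ∀ x : ℝ, x₀ ≤ x → IrregularAt[𝒜, u, c, x] := by
  obtain ⟨c, hc, x₀, hx₀⟩ := equidistributionLimit_twoModuli u hu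
  refine ⟨c, hc, x₀, fun 𝒜 h𝒜 x hx => ?_⟩
  obtain ⟨q, ℓ, ⟨hq1, hqL, -, -⟩, ⟨hℓp, hℓL, -⟩, hdich⟩ := hx₀ x hx
  obtain ⟨m, hm, y, hy1, hy2, a, ha, hdev⟩ := hdich 𝒜 h𝒜
  rcases hm with rfl | rfl
  · exact ⟨m, hq1, hqL, y, hy1, hy2, a, ha, hdev⟩
  · exact ⟨m, hℓp.one_le, hℓL, y, hy1, hy2, a, ha, hdev⟩

end Literature.Barriers.Parity

end
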